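import Summits.QuantumFields.YangMills.Theorems.FluctuationComparisonRegPrIntLS2BetaTubeGrowthAtIrreducible
import Summits.QuantumFields.YangMills.Theorems.FluctuationComparisonRegPrIntLClosedGoodFibre
import HarnessLib

/-!
# S2β · GAP♭ — (T7e) GAP♭(V,U₀) AT PRINT'S REGULAR MINIMISER OVER A CENTRAL-STABILISER DATUM:
# ⟸ {pen 4's token, `hreg`(δ)} at `γ ≤ γ*(L,b₀,p₀,δ)`, and ⟸ {pen 4's token} ALONE at a per-base-point `γ`-threshold

Cell `ym3-torus` (YM ladder rung R3 = continuum `SU(2)` Yang–Mills on the three-torus at fixed lattice data — a RUNG: NOT d = 4, NOT infinite volume,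
NOT a mass gap, NOT Clay).  Width seat `ym3-torus-px21` (gen 19), the (T)-chain of LINE g18-1 S2β ((T7a)–(T7d)).  Crux `stmt-QuantumFields-20520`
(`…Theses.UnitScaleTilt.FluctuationComparisonRegPrIntL`); `--kind proof --supports stmt-QuantumFields-20520 --as helper`, count-neutral, DEFINITION-FREE
(0 `def`, 0 `instance`, 0 `notation`, 0 `sorry`, default heartbeats).

WHY.  GAP♭(V,U₀) — the per-datum gap letter of the (T3) dock (`μ·L^{−2(K−J)}·⨅_{w residual} Σ_ℓ dist1 (U ℓ·((w•U₀) ℓ)⁻¹)² ≤ A U − minActionRegPr ε₀ V` for EVERY good history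
`U` over `V`, no tube) — follows from POS∘(δ) and ISOL∘(δ) at small `γ` by ✓px8∕px17 g14 `…S2BetaTubeGrowthOfIsolated.gapFlatAt_of_pos_of_isolated_of_closePair` (CLOSE-PAIR puts every
good history into the `δ`-tube, `γ ≤ γ₁(δ)`).  RECORD 17fx closed GAP♭ at the FLAT datum from ISOL∘ alone.  THIS FILE is the IRREDUCIBLE-datum twin: POS∘ is ✓(T7c)
`posCollar_at_isCritR2_of_centralStab_five` (no per-datum letter), ISOL∘(δ) is ✓px8 `isol_of_atMostOneCriticalOrbit` ∘ ✓pen 4 `atMostOneCriticalOrbit_of_centralStab_five` modulo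
`hreg`(δ), and `hreg` itself is free for small tubes (✓px16 g18 `exists_delta_regPr_of_tube`, `γ`-free) once CL(V) holds (✓`…ClosedGoodFibre.exists_gamma_closedGoodFibre`, `γ ≤ γ_CL`):
* §1 ★★★★ `gapFlat_at_isCritR2_of_centralStab_of_hreg_five (L) (h5) (b₀ p₀) (hb hp) (δ) (hδ) : ∃ e₉ γ* > 0, ∀ F γ (F.L = L) (0<γ≤γ*) J<K ε₀ V U₀, 0<ε₀≤e₉ →
  U₀ ∈ regFibrePr ε₀ V → A U₀ = minActionRegPr ε₀ V → U₀ ∈ histGood → ⟨pen 4's token⟩ → hreg(δ) → GAP♭` — UNIFORM `γ*(L,b₀,p₀,δ)`, one displayed row `hreg`(δ).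
* §2 ★★★★ `gapFlat_at_isCritR2_of_centralStab_five (L) (h5) (b₀ p₀) (hb hp) : ∃ e₉ > 0, ∀ F (F.L = L) J<K ε₀ V U₀, 0<ε₀≤e₉ → U₀ ∈ regFibrePr ε₀ V →
  A U₀ = minActionRegPr ε₀ V → ⟨pen 4's token⟩ → ∃ γ* > 0, ∀ γ, 0<γ≤γ* → U₀ ∈ histGood → GAP♭` — NO per-datum LETTER at all; the price is a PER-BASE-POINT `γ*` (`δ₀(U₀)` of the regular
  class enters `γ₁(δ₀)`), NOT the organ's datum-free order.
The `IsCritR2` binder of (T7b)∕(T7c) is DISCHARGED here (a minimiser over `regFibrePr ε₀ V` is R2-critical, lit ✓`isCritR2_of_isMinOn` + ✓`minActionRegPr_le`): base-point rows =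
{`U₀ ∈ regFibrePr ε₀ V`, `A U₀ = minActionRegPr ε₀ V`} = EXW∘'s.  CONSTANTS PER DATUM (`μ`, and in §2 `γ*`); thresholds `e₉(L)` from ✓(T7c).

HONEST: composition BY NAME over landed theorems; nothing of Bałaban's analysis beyond the cited tree theorems; the REDUCIBLE stratum, `hreg` at a general `δ` (§1), the organ's datum-free
`δ`∕`γ` and K-uniform `μ` (TUBE-REG∘, GAP♯∘), EXW∘, S2β, crux 20520 NOT proved; `L = 3` socket open (EMBARGO-LITE №58); no summit statement is proved by a helper; finite-volume ∕
conditional; rung R3 = SU(2) YM₃ on T³ — NOT d = 4, NOT infinite volume, NOT a mass gap, NOT Clay; the Yang–Mills mass gap is NOT proved.  Sorry-free, axioms standard.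

References: T. Bałaban, CMP **102** (1985) 277–309 [Balaban1985Variational] ((4)–(6) p.278, Thm 1 (8)–(10) p.279, Prop. 7 and (141)–(143) p.299); CMP **102** (1985) 255–275 [Balaban1985UV3]
((12)–(13) p.259, (18)–(22) p.260); CMP **99** (1985) 75–102 [Balaban1985RegularSpaces] (Lemma 1 (1.24)–(1.26) pp.79–80, Thm 2 p.83).
-/

set_option autoImplicit false

noncomputable section

namespace Summit.QuantumFields.YangMills.Theorems.FluctuationComparisonRegPrIntLS2BetaGapFlatAtIrreducible

open Set Filter Topology Function
open scoped Matrix.Norms.L2Operator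
open Literature.MathematicalPhysics.QuantumFieldTheory.Balaban1983to89
open Literature.MathematicalPhysics.QuantumFieldTheory.Balaban1983to89.T3ContinuumYM3Torus
open Literature.MathematicalPhysics.QuantumFieldTheory.Balaban1983to89.T3UnitLawDensityEML (ℰp)
open Literature.MathematicalPhysics.QuantumFieldTheory.Balaban1983to89.T3UnitScaleTilt
open Literature.MathematicalPhysics.QuantumFieldTheory.Balaban1983to89.T3TiltDescent
open Literature.MathematicalPhysics.QuantumFieldTheory.Balaban1983to89.T3ConstrainedMinimiser (fibre)
open Literature.MathematicalPhysics.QuantumFieldTheory.Balaban1983to89.T3PrintedRegularMinimiser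
open Literature.MathematicalPhysics.QuantumFieldTheory.Balaban1983to89.T3Thm1CarrierNative (IsCritR2 isCritR2_of_isMinOn)
open Literature.MathematicalPhysics.QuantumFieldTheory.Balaban1983to89.T4Continuum
open scoped Literature.MathematicalPhysics.QuantumFieldTheory.Balaban1983to89.T3OrbitAverage
open Summit.QuantumFields.YangMills.Theorems.BrascampLiebVacuumSC.DimensionGapSU2 (neg_one_mem)
open Summit.QuantumFields.YangMills.Theorems.FluctuationComparisonRegPrIntLS2BetaTubeGrowthOfIsolated (gapFlatAt_of_pos_of_isolated_of_closePair)
open Summit.QuantumFields.YangMills.Theorems.FluctuationComparisonRegPrIntLS2BetaTubeGrowthAtIrreducible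
open Summit.QuantumFields.YangMills.Theorems.FluctuationComparisonRegPrIntLS2BetaCriticalOrbitUnique (atMostOneCriticalOrbit_of_centralStab_five)
open Summit.QuantumFields.YangMills.Theorems.FluctuationComparisonRegPrIntLS2BetaIsolOfCriticalOrbitUnique (isol_of_atMostOneCriticalOrbit)
open Summit.QuantumFields.YangMills.Theorems.FluctuationComparisonRegPrIntLS2BetaTubeRegularSmall (exists_delta_regPr_of_tube)
open Summit.QuantumFields.YangMills.Theorems.FluctuationComparisonRegPrIntLClosedGoodFibre (exists_gamma_closedGoodFibre)

/-! ## §1 GAP♭ from pen 4's token and the tube-regularity row at a fixed tube radius (uniform `γ*`) -/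

section FixedTube

/-- ★★★★ **GAP♭(V,U₀) AT PRINT'S REGULAR MINIMISER OVER A CENTRAL-STABILISER DATUM ⟸ {pen 4's token, `hreg`(δ)}, UNIFORMLY IN `γ ≤ γ*(L,b₀,p₀,δ)`.**  For every `L ≥ 5`,
`b₀, p₀ > 0` and tube radius `δ > 0` there are `e₉ > 0` (✓(T7c)'s and pen 4's thresholds) and `γ* > 0` (the door's `γ₁(δ)`) such that at every member `(F, γ ≤ γ*, J < K)`, every
`0 < ε₀ ≤ e₉`, every datum `V` whose `SU(2)`-valued symmetries are `±1`, every good history `U₀ ∈ regFibrePr ε₀ V` realising `minActionRegPr ε₀ V` (hence R2-critical, lit ✓`isCritR2_of_isMinOn`), under the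
tube-regularity row `hreg`(δ) (✓px8's binder VERBATIM): GAP♭(V,U₀) (the (T3) dock's text VERBATIM).  Composition: ✓`gapFlatAt_of_pos_of_isolated_of_closePair` ∘
{✓(T7c) `posCollar_at_isCritR2_of_centralStab_five`, ✓px8 `isol_of_atMostOneCriticalOrbit` ∘ ✓pen 4}.
[cite: Balaban1985Variational, (4)-(6) p.278, Thm 1 (8)-(10) p.279, Prop. 7 and (141)-(143) p.299; Balaban1985UV3, (12)-(13) p.259 and (18)-(22) p.260; Balaban1985RegularSpaces, Lemma 1 (1.24)-(1.26) p.79] -/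
theorem gapFlat_at_isCritR2_of_centralStab_of_hreg_five (L : ℕ) (h5 : 5 ≤ L) (b₀ p₀ : ℝ) (hb : 0 < b₀) (hp : 0 < p₀) (δ : ℝ) (hδ : 0 < δ) :
    ∃ e₉ γs : ℝ, 0 < e₉ ∧ 0 < γs ∧
      ∀ (F : T3Family) (γ : ℝ), F.L = L → 0 < γ → γ ≤ γs → ∀ (J K : ℕ) (hJK : J < K) (ε₀ : ℝ)
        (V : GaugeField (F.P J) 0 (Matrix.specialUnitaryGroup (Fin 2) ℂ)) (U₀ : GaugeField (F.P K) 0 (Matrix.specialUnitaryGroup (Fin 2) ℂ)),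
        0 < ε₀ → ε₀ ≤ e₉ → U₀ ∈ regFibrePr F J K hJK.le ε₀ V →
        wilsonAction4 U₀ = minActionRegPr F J K hJK.le ε₀ V → U₀ ∈ histGood F ℰp (θBal F.L γ b₀ p₀) K J →
        (∀ s : GaugeTransf (F.P J) 0 (Matrix.specialUnitaryGroup (Fin 2) ℂ), GaugeField.gaugeAct s V = V →
          s = (fun _ => 1) ∨ s = (fun _ => (⟨-1, neg_one_mem⟩ : Matrix.specialUnitaryGroup (Fin 2) ℂ))) →
        (∀ U ∈ closure (fibre F ℰp J K hJK.le V ∩ histGood F ℰp (θBal F.L γ b₀ p₀) K J),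
            (∃ w : Site (F.P K) 0 → Matrix.specialUnitaryGroup (Fin 2) ℂ,
              (∀ U'' : GaugeField (F.P K) 0 (Matrix.specialUnitaryGroup (Fin 2) ℂ),
                  descendTo F ℰp J K hJK.le (GaugeField.gaugeAct w U'') = descendTo F ℰp J K hJK.le U'') ∧
                ∀ ℓ : PBond (F.P K) 0, dist1 (U ℓ * ((GaugeField.gaugeAct w U₀) ℓ)⁻¹) ≤ δ) →
            wilsonAction4 U ≤ minActionRegPr F J K hJK.le ε₀ V → U ∈ regFibrePr F J K hJK.le ε₀ V) →
        ∃ μ : ℝ, 0 < μ ∧ ∀ U ∈ fibre F ℰp J K hJK.le V, U ∈ histGood F ℰp (θBal F.L γ b₀ p₀) K J →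
          μ * ((F.L : ℝ)⁻¹) ^ (2 * (K - J)) *
              (⨅ w : {w : Site (F.P K) 0 → Matrix.specialUnitaryGroup (Fin 2) ℂ |
                  ∀ U : GaugeField (F.P K) 0 (Matrix.specialUnitaryGroup (Fin 2) ℂ),
                    descendTo F ℰp J K hJK.le (GaugeField.gaugeAct w U) = descendTo F ℰp J K hJK.le U},
                ∑ ℓ : PBond (F.P K) 0,
                  dist1 (U ℓ * ((GaugeField.gaugeAct (w : Site (F.P K) 0 → Matrix.specialUnitaryGroup (Fin 2) ℂ) U₀) ℓ)⁻¹) ^ 2)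
            ≤ wilsonAction4 U - minActionRegPr F J K hJK.le ε₀ V := by
  obtain ⟨e₈, he₈, HP⟩ := posCollar_at_isCritR2_of_centralStab_five L h5
  obtain ⟨e₈', he₈', H1⟩ := atMostOneCriticalOrbit_of_centralStab_five L h5
  obtain ⟨γ₁, hγ₁, HG⟩ := gapFlatAt_of_pos_of_isolated_of_closePair L b₀ p₀ hb hp δ hδ
  refine ⟨min e₈ e₈', γ₁, lt_min he₈ he₈', hγ₁, ?_⟩
  intro F γ hF hγ hγle J K hJK ε₀ V U₀ hε₀ hεe hU₀reg hmin hU₀h hstab hreg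
  have hU₀fib : U₀ ∈ fibre F ℰp J K hJK.le V := ((mem_regFibrePr_iff F).1 hU₀reg).1
  have hcrit : IsCritR2 F J K hJK.le V U₀ :=
    isCritR2_of_isMinOn hε₀ hU₀reg (isMinOn_iff.mpr fun W hW => hmin.trans_le (minActionRegPr_le F hW))
  have hpos := HP F hF J K hJK γ b₀ p₀ ε₀ V U₀ δ hε₀ (hεe.trans (min_le_left _ _)) hU₀reg hcrit hmin hstab
  have h1 := H1 F hF J K hJK ε₀ V hε₀ (hεe.trans (min_le_right _ _)) hstab
  have hisol := isol_of_atMostOneCriticalOrbit F hJK.le hε₀ V U₀ δ h1 hU₀reg hmin hreg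
  exact HG F γ hF hγ hγle J K hJK.le ε₀ V U₀ hU₀fib hU₀h hpos hisol

end FixedTube

/-! ## §2 GAP♭ from pen 4's token ALONE, at a per-base-point `γ`-threshold -/

section SmallGamma

/-- ★★★★ **GAP♭(V,U₀) AT PRINT'S REGULAR MINIMISER OVER A CENTRAL-STABILISER DATUM ⟸ pen 4's token ALONE, for all `γ ≤ γ*(U₀)`.**  For every `L ≥ 5` and `b₀, p₀ > 0` there is
`e₉ > 0` such that at every member `(F, J < K)`, every `0 < ε₀ ≤ e₉`, every datum `V` whose `SU(2)`-valued symmetries are `±1` and every `U₀ ∈ regFibrePr ε₀ V`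
realising `minActionRegPr ε₀ V` (hence R2-critical), there is `γ* > 0` with: for every `0 < γ ≤ γ*` such that `U₀` is a good history, GAP♭(V,U₀) (VERBATIM).  The `hreg` row of §1 is discharged at the
tube radius `δ₀(U₀)` of ✓px16 `exists_delta_regPr_of_tube` (the regular class absorbs a sup-tube about every gauge translate of `U₀`, `γ`-free) together with CL(V) from
✓`exists_gamma_closedGoodFibre` (`γ ≤ γ_CL(L,b₀,p₀)`); then §1's mechanism at `δ := δ₀(U₀)`, `γ* := min γ_CL γ₁(δ₀)`.  NO per-datum letter remains; the price is the per-base-point `γ*`.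
[cite: Balaban1985Variational, (4)-(6) p.278, Thm 1 (8)-(10) p.279, Prop. 7 and (141)-(143) p.299; Balaban1985UV3, (12)-(13) p.259 and (18)-(22) p.260; Balaban1985RegularSpaces, Lemma 1 (1.24)-(1.26) p.79] -/
theorem gapFlat_at_isCritR2_of_centralStab_five (L : ℕ) (h5 : 5 ≤ L) (b₀ p₀ : ℝ) (hb : 0 < b₀) (hp : 0 < p₀) :
    ∃ e₉ : ℝ, 0 < e₉ ∧
      ∀ (F : T3Family), F.L = L → ∀ (J K : ℕ) (hJK : J < K) (ε₀ : ℝ)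
        (V : GaugeField (F.P J) 0 (Matrix.specialUnitaryGroup (Fin 2) ℂ)) (U₀ : GaugeField (F.P K) 0 (Matrix.specialUnitaryGroup (Fin 2) ℂ)),
        0 < ε₀ → ε₀ ≤ e₉ → U₀ ∈ regFibrePr F J K hJK.le ε₀ V →
        wilsonAction4 U₀ = minActionRegPr F J K hJK.le ε₀ V →
        (∀ s : GaugeTransf (F.P J) 0 (Matrix.specialUnitaryGroup (Fin 2) ℂ), GaugeField.gaugeAct s V = V →
          s = (fun _ => 1) ∨ s = (fun _ => (⟨-1, neg_one_mem⟩ : Matrix.specialUnitaryGroup (Fin 2) ℂ))) →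
        ∃ γs : ℝ, 0 < γs ∧ ∀ (γ : ℝ), 0 < γ → γ ≤ γs → U₀ ∈ histGood F ℰp (θBal F.L γ b₀ p₀) K J →
        ∃ μ : ℝ, 0 < μ ∧ ∀ U ∈ fibre F ℰp J K hJK.le V, U ∈ histGood F ℰp (θBal F.L γ b₀ p₀) K J →
          μ * ((F.L : ℝ)⁻¹) ^ (2 * (K - J)) *
              (⨅ w : {w : Site (F.P K) 0 → Matrix.specialUnitaryGroup (Fin 2) ℂ |
                  ∀ U : GaugeField (F.P K) 0 (Matrix.specialUnitaryGroup (Fin 2) ℂ),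
                    descendTo F ℰp J K hJK.le (GaugeField.gaugeAct w U) = descendTo F ℰp J K hJK.le U},
                ∑ ℓ : PBond (F.P K) 0,
                  dist1 (U ℓ * ((GaugeField.gaugeAct (w : Site (F.P K) 0 → Matrix.specialUnitaryGroup (Fin 2) ℂ) U₀) ℓ)⁻¹) ^ 2)
            ≤ wilsonAction4 U - minActionRegPr F J K hJK.le ε₀ V := by
  obtain ⟨e₈, he₈, HP⟩ := posCollar_at_isCritR2_of_centralStab_five L h5
  obtain ⟨e₈', he₈', H1⟩ := atMostOneCriticalOrbit_of_centralStab_five L h5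
  obtain ⟨γCL, hγCL, -, HCL⟩ := exists_gamma_closedGoodFibre L (b₀ := b₀) (p₀ := p₀) hb hp
  refine ⟨min e₈ e₈', lt_min he₈ he₈', ?_⟩
  intro F hF J K hJK ε₀ V U₀ hε₀ hεe hU₀reg hmin hstab
  have hU₀fib : U₀ ∈ fibre F ℰp J K hJK.le V := ((mem_regFibrePr_iff F).1 hU₀reg).1
  have hcrit : IsCritR2 F J K hJK.le V U₀ :=
    isCritR2_of_isMinOn hε₀ hU₀reg (isMinOn_iff.mpr fun W hW => hmin.trans_le (minActionRegPr_le F hW))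
  have hU₀R : RegPr F J K ε₀ U₀ := ((mem_regFibrePr_iff F).1 hU₀reg).2
  -- the `γ`-free tube radius of the regular class at `U₀`
  obtain ⟨δ₀, hδ₀, Hreg⟩ := exists_delta_regPr_of_tube F hε₀.le hU₀R
  obtain ⟨γ₁, hγ₁, HG⟩ := gapFlatAt_of_pos_of_isolated_of_closePair L b₀ p₀ hb hp δ₀ hδ₀
  refine ⟨min γCL γ₁, lt_min hγCL hγ₁, fun γ hγ hγle hU₀h => ?_⟩
  have hCL := HCL F γ hF hγ (hγle.trans (min_le_left _ _)) J K hJK.le V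
  -- `hreg` at `δ₀`
  have hreg : ∀ U ∈ closure (fibre F ℰp J K hJK.le V ∩ histGood F ℰp (θBal F.L γ b₀ p₀) K J),
      (∃ w : Site (F.P K) 0 → Matrix.specialUnitaryGroup (Fin 2) ℂ,
        (∀ U'' : GaugeField (F.P K) 0 (Matrix.specialUnitaryGroup (Fin 2) ℂ),
            descendTo F ℰp J K hJK.le (GaugeField.gaugeAct w U'') = descendTo F ℰp J K hJK.le U'') ∧
          ∀ ℓ : PBond (F.P K) 0, dist1 (U ℓ * ((GaugeField.gaugeAct w U₀) ℓ)⁻¹) ≤ δ₀) →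
      wilsonAction4 U ≤ minActionRegPr F J K hJK.le ε₀ V → U ∈ regFibrePr F J K hJK.le ε₀ V := by
    intro U hU hw _
    obtain ⟨w, -, hwℓ⟩ := hw
    exact (mem_regFibrePr_iff F).2 ⟨hCL hU, Hreg w U hwℓ⟩
  have hpos := HP F hF J K hJK γ b₀ p₀ ε₀ V U₀ δ₀ hε₀ (hεe.trans (min_le_left _ _)) hU₀reg hcrit hmin hstab
  have h1 := H1 F hF J K hJK ε₀ V hε₀ (hεe.trans (min_le_right _ _)) hstab
  have hisol := isol_of_atMostOneCriticalOrbit F hJK.le hε₀ V U₀ δ₀ h1 hU₀reg hmin hreg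
  exact HG F γ hF hγ (hγle.trans (min_le_right _ _)) J K hJK.le ε₀ V U₀ hU₀fib hU₀h hpos hisol

end SmallGamma

end Summit.QuantumFields.YangMills.Theorems.FluctuationComparisonRegPrIntLS2BetaGapFlatAtIrreducible

end
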